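import Summits.Ventures.PercRepro.C041MultiExitSets
import Summits.Ventures.PercRepro.C041BlockCount

/-!
# ROW C-041 — THE MULTI-EXIT ATTACHMENT, COUNTED: the six anchor classes over the colourings of the multigraph,
by the status pattern of the exits (p6, gen 33; mine-3's C-041.md §20 (c) BLOCK MAPS with `r` exits)

Setting of `C041MultiExitSets`: `hang Z₁ u Z a`, anchor `inl a₁`.  A state is a colouring `ω` of `Z₁` with a
state of every zone (`stateEquiv`), and every count of the attachment is a sum over `ω` of a count on tuples of
zone states (`card_filter_eq`).  THE ANCHOR CLASSES `(c1, c2, k)` — admissible, not deleted (if `c1`), not deleted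
on side `2` (if `c2`), blue at `K` (if `k`) — are the conditions `fibCond` on the tuple (`mem_Fset_iff` …
`mem_IBset_iff`).  For a FIXED colouring `ω` the exits split into the MERGED ones (`merged`: blue-connected to the
anchor) and the separated ones, the latter into the BLOCKS of blue connectivity inside `Z₁` (`blk`, `blocks`);
the fibre of the class `(c1, c2, k)` is exactly the set of tuples whose merged coordinates lie in the one-zone
classes `cls … c1 c2 k` of `C041TwoExitCount` and whose every block has all its coordinates in the class
`(F, T, k)` or all in `(T, F, k)` (`fibCond_iff`: a block is ONE sub-zone of the attachment, admissible iff it does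
not carry a blue `1`-mark from one zone and a blue `2`-mark from another), so by `C041BlockCount` its count is

  `∏_{k merged} #cls(c1, c2, k) · ∏_{B} (∏_{k ∈ B} #cls(F, T, k) + ∏_{k ∈ B} #cls(T, F, k) − ∏_{k ∈ B} #cls(T, T, k))`

(`card_fib`, `cls_inter`).  The six-vector form, THEOREM (BLOCK MAP, `r` EXITS), is the next module.
-/

namespace PercRepro

namespace ZoneZ

namespace MultiExit

open ZoneData Pendant Finset TwoExit BlockCount

variable {ι V₁ E₁ U₁ U₂ : Type} {V E T₁ T₂ : ι → Type}
variable (Z₁ : ZoneData V₁ E₁ U₁ U₂) (u : ι → V₁) (Z : (k : ι) → ZoneData (V k) (E k) (T₁ k) (T₂ k))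
  (a : (k : ι) → V k) (a₁ : V₁)

/-! ## The states of the attachment are pairs: a colouring of `Z₁`, a tuple of zone states -/

/-- The states of the attachment: a colouring of `Z₁` with a state of every zone. -/
def stateEquiv : State (E₁ ⊕ (Σ k, E k)) (Σ k, T₁ k) (Σ k, T₂ k) ≃
    (E₁ → Bool) × ((k : ι) → State (E k) (T₁ k) (T₂ k)) where
  toFun σ := (col₁ σ, st σ)
  invFun p := (Sum.elim p.1 (fun e => (p.2 e.1).1 e.2), fun t => (p.2 t.1).2.1 t.2, fun t => (p.2 t.1).2.2 t.2)
  left_inv σ := by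
    obtain ⟨c, m₁, m₂⟩ := σ
    refine Prod.ext ?_ (Prod.ext ?_ ?_)
    · funext e
      rcases e with e | ⟨k, e⟩ <;> rfl
    · funext t
      rfl
    · funext t
      rfl
  right_inv p := by
    obtain ⟨ω, f⟩ := p
    rfl

/-- The equivalence, applied. -/
theorem stateEquiv_apply (σ : State (E₁ ⊕ (Σ k, E k)) (Σ k, T₁ k) (Σ k, T₂ k)) :
    stateEquiv σ = (col₁ σ, st σ) := rfl

/-! ## The statuses of the exits under a colouring: merged exits and blocks -/

variable [Fintype ι]

open Classical in
/-- The MERGED exits under `ω`: blue-connected to the anchor. -/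
noncomputable def merged (ω : E₁ → Bool) : Finset ι := univ.filter fun k => Z₁.Mg a₁ (u k) ω

open Classical in
/-- The BLOCK of the exit `k` under `ω`: the separated exits blue-connected to `u k`. -/
noncomputable def blk (ω : E₁ → Bool) (k : ι) : Finset ι :=
  univ.filter fun l => ¬ Z₁.Mg a₁ (u l) ω ∧ Z₁.Mg (u k) (u l) ω

open Classical in
/-- The BLOCKS under `ω`: the blocks of the separated exits. -/
noncomputable def blocks (ω : E₁ → Bool) : Finset (Finset ι) :=
  (univ.filter fun k => ¬ Z₁.Mg a₁ (u k) ω).image (blk Z₁ u a₁ ω)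

/-- Membership in the merged exits. -/
theorem mem_merged (ω : E₁ → Bool) (k : ι) : k ∈ merged Z₁ u a₁ ω ↔ Z₁.Mg a₁ (u k) ω := by
  classical
  unfold merged
  rw [Finset.mem_filter]
  exact and_iff_right (Finset.mem_univ _)

/-- Membership in a block. -/
theorem mem_blk (ω : E₁ → Bool) (k l : ι) :
    l ∈ blk Z₁ u a₁ ω k ↔ ¬ Z₁.Mg a₁ (u l) ω ∧ Z₁.Mg (u k) (u l) ω := by
  classical
  unfold blk
  rw [Finset.mem_filter]
  exact and_iff_right (Finset.mem_univ _)

/-- Membership in the blocks. -/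
theorem mem_blocks (ω : E₁ → Bool) (B : Finset ι) :
    B ∈ blocks Z₁ u a₁ ω ↔ ∃ k, ¬ Z₁.Mg a₁ (u k) ω ∧ blk Z₁ u a₁ ω k = B := by
  classical
  unfold blocks
  rw [Finset.mem_image]
  constructor
  · rintro ⟨k, hk, rfl⟩
    rw [Finset.mem_filter] at hk
    exact ⟨k, hk.2, rfl⟩
  · rintro ⟨k, hk, rfl⟩
    exact ⟨k, Finset.mem_filter.2 ⟨Finset.mem_univ _, hk⟩, rfl⟩

/-- A separated exit lies in its own block. -/
theorem self_mem_blk (ω : E₁ → Bool) (k : ι) (hk : ¬ Z₁.Mg a₁ (u k) ω) : k ∈ blk Z₁ u a₁ ω k :=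
  (mem_blk Z₁ u a₁ ω k k).2 ⟨hk, Mg_refl Z₁ ω (u k)⟩

/-- The block of a member of a block is that block. -/
theorem blk_eq_of_mem (ω : E₁ → Bool) {k l : ι} (hl : l ∈ blk Z₁ u a₁ ω k) :
    blk Z₁ u a₁ ω l = blk Z₁ u a₁ ω k := by
  obtain ⟨-, hc⟩ := (mem_blk Z₁ u a₁ ω k l).1 hl
  ext x
  rw [mem_blk, mem_blk]
  constructor
  · rintro ⟨hx, hlx⟩
    exact ⟨hx, Mg_trans Z₁ ω _ _ _ hc hlx⟩
  · rintro ⟨hx, hkx⟩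
    exact ⟨hx, Mg_trans Z₁ ω _ _ _ (Mg_symm Z₁ ω _ _ hc) hkx⟩

/-- The merged exits are disjoint from every block. -/
theorem disjoint_merged_blocks (ω : E₁ → Bool) : ∀ B ∈ blocks Z₁ u a₁ ω, Disjoint (merged Z₁ u a₁ ω) B := by
  intro B hB
  obtain ⟨k, -, rfl⟩ := (mem_blocks Z₁ u a₁ ω B).1 hB
  rw [Finset.disjoint_left]
  intro x hxM hxB
  exact ((mem_blk Z₁ u a₁ ω k x).1 hxB).1 ((mem_merged Z₁ u a₁ ω x).1 hxM)

/-- Distinct blocks are disjoint. -/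
theorem blocks_pairwise (ω : E₁ → Bool) :
    ∀ B ∈ blocks Z₁ u a₁ ω, ∀ B' ∈ blocks Z₁ u a₁ ω, B ≠ B' → Disjoint B B' := by
  intro B hB B' hB' hne
  obtain ⟨k, -, rfl⟩ := (mem_blocks Z₁ u a₁ ω B).1 hB
  obtain ⟨k', -, rfl⟩ := (mem_blocks Z₁ u a₁ ω B').1 hB'
  rw [Finset.disjoint_left]
  intro x hx hx'
  exact hne ((blk_eq_of_mem Z₁ u a₁ ω hx).symm.trans (blk_eq_of_mem Z₁ u a₁ ω hx'))

/-- Every exit is merged or lies in a block. -/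
theorem merged_or_mem_blocks (ω : E₁ → Bool) : ∀ k, k ∈ merged Z₁ u a₁ ω ∨ ∃ B ∈ blocks Z₁ u a₁ ω, k ∈ B := by
  intro k
  by_cases hk : Z₁.Mg a₁ (u k) ω
  · exact Or.inl ((mem_merged Z₁ u a₁ ω k).2 hk)
  · exact Or.inr ⟨blk Z₁ u a₁ ω k, (mem_blocks Z₁ u a₁ ω _).2 ⟨k, hk, rfl⟩, self_mem_blk Z₁ u a₁ ω k hk⟩

/-- Two members of one block are blue-connected. -/
theorem Mg_of_mem_blk (ω : E₁ → Bool) {k l l' : ι} (hl : l ∈ blk Z₁ u a₁ ω k) (hl' : l' ∈ blk Z₁ u a₁ ω k) :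
    Z₁.Mg (u l) (u l') ω :=
  Mg_trans Z₁ ω _ _ _ (Mg_symm Z₁ ω _ _ ((mem_blk Z₁ u a₁ ω k l).1 hl).2) ((mem_blk Z₁ u a₁ ω k l').1 hl').2

section Counts

variable [DecidableEq ι] [∀ k, Fintype (E k)] [∀ k, DecidableEq (E k)] [∀ k, Fintype (T₁ k)]
  [∀ k, DecidableEq (T₁ k)] [∀ k, Fintype (T₂ k)] [∀ k, DecidableEq (T₂ k)]

/-! ## The anchor classes as conditions on the tuple -/

/-- The condition on a colouring `ω` of `Z₁` and a tuple `τ` of zone states for the corresponding state of the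
attachment to lie in the anchor class `(c1, c2, k)`: admissible; not deleted if `c1`; not deleted on side `2` if
`c2`; blue at `K` if `k` (`C041MultiExitSets`: `adm_iff`, `anchor_mem_D_iff`, `anchor_mem_D2_iff`, `blueK_iff`). -/
def fibCond (ω : E₁ → Bool) (c1 c2 kk : Bool) (τ : (k : ι) → State (E k) (T₁ k) (T₂ k)) : Prop :=
  (∀ k, (Z k).adm (τ k)) ∧
    (∀ k l, a k ∈ (Z k).D2 (τ k) → a l ∈ (Z l).D (τ l) → ¬ Z₁.Mg (u k) (u l) ω) ∧
    (c1 = true → ¬ ∃ k, Z₁.Mg a₁ (u k) ω ∧ a k ∈ (Z k).D (τ k)) ∧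
    (c2 = true → ¬ ∃ k, Z₁.Mg a₁ (u k) ω ∧ a k ∈ (Z k).D2 (τ k)) ∧
    (kk = true → ∀ k, Z₁.Rd a₁ (u k) ω → (Z k).blueK {a k} (τ k))

/-! ## The fibre condition by the status pattern -/

/-- The classes `(F, T)` and `(T, F)` meet in `(T, T)`. -/
theorem cls_inter {W F S₁ S₂ : Type} (Y : ZoneData W F S₁ S₂) (b : W) [Fintype F] [Fintype S₁] [Fintype S₂]
    (k : Bool) (r : Prop) : cls Y b false true k r ∩ cls Y b true false k r = cls Y b true true k r := by
  ext τ
  rw [Finset.mem_inter, mem_cls, mem_cls, mem_cls]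
  simp only [Bool.false_eq_true, false_implies, true_implies, true_and]
  tauto

omit [(k : ι) → DecidableEq (E k)] [(k : ι) → DecidableEq (T₁ k)] [(k : ι) → DecidableEq (T₂ k)] in
/-- **The fibre condition by the status pattern**: for a class with `c1` or `c2`, the merged exits' zones lie in
the one-zone classes `(c1, c2, k)` and every block has all its zones in the class `(F, T, k)` or all in `(T, F, k)`. -/
theorem fibCond_iff (ω : E₁ → Bool) (c1 c2 kk : Bool) (hc : c1 = true ∨ c2 = true)
    (τ : (k : ι) → State (E k) (T₁ k) (T₂ k)) :
    fibCond Z₁ u Z a a₁ ω c1 c2 kk τ ↔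
      (∀ k ∈ merged Z₁ u a₁ ω, τ k ∈ cls (Z k) (a k) c1 c2 kk (Z₁.Rd a₁ (u k) ω)) ∧
        ∀ B ∈ blocks Z₁ u a₁ ω, (∀ k ∈ B, τ k ∈ cls (Z k) (a k) false true kk (Z₁.Rd a₁ (u k) ω)) ∨
          (∀ k ∈ B, τ k ∈ cls (Z k) (a k) true false kk (Z₁.Rd a₁ (u k) ω)) := by
  constructor
  · rintro ⟨hadm, hpair, hc1, hc2, hk⟩
    refine ⟨fun k hkM => ?_, fun B hB => ?_⟩
    · rw [mem_merged] at hkM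
      rw [mem_cls]
      exact ⟨hadm k, fun h1 hD => hc1 h1 ⟨k, hkM, hD⟩, fun h2 hD => hc2 h2 ⟨k, hkM, hD⟩,
        fun hkk hr => hk hkk k hr⟩
    · obtain ⟨k, -, rfl⟩ := (mem_blocks Z₁ u a₁ ω B).1 hB
      by_cases hP : ∀ l ∈ blk Z₁ u a₁ ω k, a l ∉ (Z l).D2 (τ l)
      · left
        intro l hl
        rw [mem_cls]
        exact ⟨hadm l, fun h => absurd h Bool.false_ne_true, fun _ => hP l hl, fun hkk hr => hk hkk l hr⟩
      · right
        obtain ⟨l', hl'⟩ := not_forall.1 hP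
        obtain ⟨hl'B, hD2⟩ := Classical.not_imp.1 hl'
        rw [not_not] at hD2
        intro l hl
        rw [mem_cls]
        refine ⟨hadm l, fun _ hD => ?_, fun h => absurd h Bool.false_ne_true, fun hkk hr => hk hkk l hr⟩
        exact hpair l' l hD2 hD (Mg_of_mem_blk Z₁ u a₁ ω hl'B hl)
  · rintro ⟨hM, hB⟩
    have hcl : ∀ k, ∃ c1' c2', τ k ∈ cls (Z k) (a k) c1' c2' kk (Z₁.Rd a₁ (u k) ω) := by
      intro k
      rcases merged_or_mem_blocks Z₁ u a₁ ω k with hkM | ⟨B, hBb, hkB⟩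
      · exact ⟨c1, c2, hM k hkM⟩
      · rcases hB B hBb with hP | hQ
        · exact ⟨false, true, hP k hkB⟩
        · exact ⟨true, false, hQ k hkB⟩
    refine ⟨fun k => ?_, fun k l hk2 hl1 hc' => ?_, fun h1 => ?_, fun h2 => ?_, fun hkk k hr => ?_⟩
    · obtain ⟨c1', c2', hk⟩ := hcl k
      exact ((mem_cls _ _ _ _ _ _ _).1 hk).1
    · by_cases hkM : Z₁.Mg a₁ (u k) ω
      · have hlM : Z₁.Mg a₁ (u l) ω := Mg_trans Z₁ ω _ _ _ hkM hc'
        rcases hc with h1 | h2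
        · exact ((mem_cls _ _ _ _ _ _ _).1 (hM l ((mem_merged Z₁ u a₁ ω l).2 hlM))).2.1 h1 hl1
        · exact ((mem_cls _ _ _ _ _ _ _).1 (hM k ((mem_merged Z₁ u a₁ ω k).2 hkM))).2.2.1 h2 hk2
      · have hlM : ¬ Z₁.Mg a₁ (u l) ω := fun h => hkM (Mg_trans Z₁ ω _ _ _ h (Mg_symm Z₁ ω _ _ hc'))
        have hlB : l ∈ blk Z₁ u a₁ ω k := (mem_blk Z₁ u a₁ ω k l).2 ⟨hlM, hc'⟩
        have hkB : k ∈ blk Z₁ u a₁ ω k := self_mem_blk Z₁ u a₁ ω k hkM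
        have hBb : blk Z₁ u a₁ ω k ∈ blocks Z₁ u a₁ ω := (mem_blocks Z₁ u a₁ ω _).2 ⟨k, hkM, rfl⟩
        rcases hB _ hBb with hP | hQ
        · exact ((mem_cls _ _ _ _ _ _ _).1 (hP k hkB)).2.2.1 rfl hk2
        · exact ((mem_cls _ _ _ _ _ _ _).1 (hQ l hlB)).2.1 rfl hl1
    · rintro ⟨k, hkM, hD⟩
      exact ((mem_cls _ _ _ _ _ _ _).1 (hM k ((mem_merged Z₁ u a₁ ω k).2 hkM))).2.1 h1 hD
    · rintro ⟨k, hkM, hD⟩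
      exact ((mem_cls _ _ _ _ _ _ _).1 (hM k ((mem_merged Z₁ u a₁ ω k).2 hkM))).2.2.1 h2 hD
    · obtain ⟨c1', c2', hk⟩ := hcl k
      exact ((mem_cls _ _ _ _ _ _ _).1 hk).2.2.2 hkk hr

/-! ## The fibre and its count -/

open Classical in
/-- The fibre of the class `(c1, c2, k)` over the colouring `ω`: the tuples of zone states satisfying `fibCond`. -/
noncomputable def fib (ω : E₁ → Bool) (c1 c2 k : Bool) : Finset ((k : ι) → State (E k) (T₁ k) (T₂ k)) :=
  univ.filter fun τ => fibCond Z₁ u Z a a₁ ω c1 c2 k τ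

/-- Membership in a fibre. -/
theorem mem_fib (ω : E₁ → Bool) (c1 c2 k : Bool) (τ : (k : ι) → State (E k) (T₁ k) (T₂ k)) :
    τ ∈ fib Z₁ u Z a a₁ ω c1 c2 k ↔ fibCond Z₁ u Z a a₁ ω c1 c2 k τ := by
  classical
  unfold fib
  rw [Finset.mem_filter]
  exact and_iff_right (Finset.mem_univ _)

/-- **The fibre count by the status pattern**: the product of the merged exits' class counts times, over the
blocks, the inclusion–exclusion `∏ #cls(F,T) + ∏ #cls(T,F) − ∏ #cls(T,T)`. -/
theorem card_fib (ω : E₁ → Bool) (c1 c2 kk : Bool) (hc : c1 = true ∨ c2 = true) :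
    (#(fib Z₁ u Z a a₁ ω c1 c2 kk) : ℝ) =
      (∏ k ∈ merged Z₁ u a₁ ω, (#(cls (Z k) (a k) c1 c2 kk (Z₁.Rd a₁ (u k) ω)) : ℝ)) *
        ∏ B ∈ blocks Z₁ u a₁ ω,
          ((∏ k ∈ B, (#(cls (Z k) (a k) false true kk (Z₁.Rd a₁ (u k) ω)) : ℝ)) +
            (∏ k ∈ B, (#(cls (Z k) (a k) true false kk (Z₁.Rd a₁ (u k) ω)) : ℝ)) -
            ∏ k ∈ B, (#(cls (Z k) (a k) true true kk (Z₁.Rd a₁ (u k) ω)) : ℝ)) := by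
  classical
  have h := card_filter_blocks (fun k => cls (Z k) (a k) false true kk (Z₁.Rd a₁ (u k) ω))
    (fun k => cls (Z k) (a k) true false kk (Z₁.Rd a₁ (u k) ω)) (blocks Z₁ u a₁ ω) (merged Z₁ u a₁ ω)
    (fun k => cls (Z k) (a k) c1 c2 kk (Z₁.Rd a₁ (u k) ω)) (disjoint_merged_blocks Z₁ u a₁ ω)
    (blocks_pairwise Z₁ u a₁ ω) (merged_or_mem_blocks Z₁ u a₁ ω)
    (fun τ => fibCond Z₁ u Z a a₁ ω c1 c2 kk τ) (fibCond_iff Z₁ u Z a a₁ ω c1 c2 kk hc)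
  simp only [blockC, cls_inter] at h
  rw [← h]
  unfold fib
  congr 1

/-! ## The six anchor classes, as conditions on the pair -/

variable [Fintype E₁] [DecidableEq E₁]

/-- A filter on the states of the attachment, as a filter on pairs. -/
theorem card_filter_eq (Q : State (E₁ ⊕ (Σ k, E k)) (Σ k, T₁ k) (Σ k, T₂ k) → Prop)
    (Q' : (E₁ → Bool) × ((k : ι) → State (E k) (T₁ k) (T₂ k)) → Prop) [DecidablePred Q] [DecidablePred Q']
    (h : ∀ σ, Q σ ↔ Q' (col₁ σ, st σ)) : #(univ.filter Q) = #(univ.filter Q') := by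
  refine Finset.card_equiv (stateEquiv (ι := ι) (E₁ := E₁) (E := E) (T₁ := T₁) (T₂ := T₂)) fun σ => ?_
  rw [Finset.mem_filter, Finset.mem_filter]
  simp only [Finset.mem_univ, true_and, stateEquiv_apply]
  exact h σ

variable (σ : State (E₁ ⊕ (Σ k, E k)) (Σ k, T₁ k) (Σ k, T₂ k))

/-- `F`: the class `(T, T, F)`. -/
theorem mem_Fset_iff :
    σ ∈ (hang Z₁ u Z a).Fset (Sum.inl a₁) ↔ fibCond Z₁ u Z a a₁ (col₁ σ) true true false (st σ) := by
  rw [mem_Fset, adm_iff, anchor_mem_D_iff, anchor_mem_D2_iff]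
  simp only [fibCond, Bool.false_eq_true, false_implies, and_true, true_implies, and_assoc]

/-- `F + T₁`: the class `(F, T, F)`. -/
theorem mem_FAset_iff :
    σ ∈ (hang Z₁ u Z a).FAset (Sum.inl a₁) ↔ fibCond Z₁ u Z a a₁ (col₁ σ) false true false (st σ) := by
  rw [mem_FAset, adm_iff, anchor_mem_D2_iff]
  simp only [fibCond, Bool.false_eq_true, false_implies, and_true, true_implies, true_and, and_assoc]

/-- `F + T₂`: the class `(T, F, F)`. -/
theorem mem_FBset_iff :
    σ ∈ (hang Z₁ u Z a).FBset (Sum.inl a₁) ↔ fibCond Z₁ u Z a a₁ (col₁ σ) true false false (st σ) := by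
  rw [mem_FBset, adm_iff, anchor_mem_D_iff]
  simp only [fibCond, Bool.false_eq_true, false_implies, and_true, true_implies, and_assoc]

/-- `I_F`: the class `(T, T, T)`. -/
theorem mem_IFset_iff :
    σ ∈ (hang Z₁ u Z a).IFset (Sum.inl a₁) ↔ fibCond Z₁ u Z a a₁ (col₁ σ) true true true (st σ) := by
  rw [mem_IFset, adm_iff, anchor_mem_D_iff, anchor_mem_D2_iff, blueK_iff]
  simp only [fibCond, true_implies, and_assoc]
  tauto

/-- `I_F + I₁`: the class `(F, T, T)`. -/
theorem mem_IAset_iff :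
    σ ∈ (hang Z₁ u Z a).IAset (Sum.inl a₁) ↔ fibCond Z₁ u Z a a₁ (col₁ σ) false true true (st σ) := by
  rw [mem_IAset, adm_iff, anchor_mem_D2_iff, blueK_iff]
  simp only [fibCond, Bool.false_eq_true, false_implies, true_implies, true_and, and_assoc]
  tauto

/-- `I_F + I₂`: the class `(T, F, T)`. -/
theorem mem_IBset_iff :
    σ ∈ (hang Z₁ u Z a).IBset (Sum.inl a₁) ↔ fibCond Z₁ u Z a a₁ (col₁ σ) true false true (st σ) := by
  rw [mem_IBset, adm_iff, anchor_mem_D_iff, blueK_iff]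
  simp only [fibCond, Bool.false_eq_true, false_implies, true_implies, true_and, and_assoc]
  tauto

end Counts

end MultiExit

end ZoneZ

end PercRepro
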